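import Summits.Ventures.PercRepro.S1CFCapsTools
import Summits.Ventures.PercRepro.S1CFGSmall

/-!
# PercRepro — LEMMA K ON ANY `n ≥ 11` POINTS: «MANY PARALLEL PAIRS KILL THE SHORT CIRCUITS» (p1, gen 38)

The `12`-point LEMMA K of S1CFCapsTools (p1, gen 37) for every ground set of `n ≥ 11` points:
**`not_isCircuit_of_four_le_ncard_dep_pairs`** — in a loopless coloop-free matroid of nullity `4` on `n ≥ 11` points with
`≥ 4` dependent pairs there is NO circuit of size `3` or `4`. The set `U` of points with a parallel partner has nullity
`≥ 3` (by the relative circuit count, `≤ 3` pairs live in a set of nullity `≤ 2`), hence exactly `3` (`U ≠ E`: `E` is not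
covered by parallel pairs, `2 · (n − 4) > n`) and `|U| ≤ 6` (`2 · rk U ≤ |U|`); a short circuit `C ⊄ U` raises the nullity
of `U ∪ C` (`≤ 10 < n` points) to `4`; a short circuit `C ⊆ U` together with one partner of each of its points is a set
of `2|C| ≤ 8 < n` points inside `cl C` (rank `|C| − 1`), of nullity `|C| + 1 ≥ 4`. The bound `n ≥ 11` is where the first
argument needs it (`|U ∪ C| ≤ 10`). Nothing about any cell is claimed. Axioms: standard.
-/

open scoped Matroid

namespace PercRepro

namespace S1CFG

open Set S1CF

variable {α : Type}

/-- **LEMMA K** (`n ≥ 11`): with `≥ 4` dependent pairs there is no circuit of size `3` or `4`. -/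
theorem not_isCircuit_of_four_le_ncard_dep_pairs (M : Matroid α) [M.Finite] (hL : ∀ e ∈ M.E, ¬ M.IsLoop e)
    (hK : ∀ e, ¬ M.IsColoop e) (hd : M.E.encard = M.eRank + ((4 : ℕ) : ℕ∞)) (hn : 11 ≤ M.E.ncard)
    (h4 : 4 ≤ {P : Set α | P ⊆ M.E ∧ P.ncard = 2 ∧ M.Dep P}.ncard) {C : Set α} (hC : M.IsCircuit C)
    (hC3 : 3 ≤ C.ncard) (hC4 : C.ncard ≤ 4) : False := by
  classical
  have hEfin := M.ground_finite
  have hCE : C ⊆ M.E := hC.subset_ground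
  have hCfin : C.Finite := hEfin.subset hCE
  -- the points with a partner
  set U := {u ∈ M.E | ∃ v ∈ M.E, v ≠ u ∧ M.Dep {u, v}} with hUdef
  have hUE : U ⊆ M.E := fun u hu => hu.1
  have hUfin : U.Finite := hEfin.subset hUE
  -- all dependent pairs are relative circuits of `U`
  have hpairs : {P : Set α | P ⊆ M.E ∧ P.ncard = 2 ∧ M.Dep P} ⊆
      {P : Set α | P ⊆ U ∧ P.ncard = 2 ∧ M.Dep (∅ ∪ P) ∧ ∀ Q, Q ⊂ P → M.Indep (∅ ∪ Q)} := by
    intro P hP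
    obtain ⟨hPE, hP2, hPdep⟩ := hP
    refine ⟨?_, hP2, by simpa using hPdep, fun Q hQ => by simpa using indep_of_ssubset_pair M hL hPE hP2 hQ⟩
    intro u huP
    refine ⟨hPE huP, ?_⟩
    obtain ⟨a, b, hab, rfl⟩ := Set.ncard_eq_two.1 hP2
    rcases huP with rfl | rfl
    · exact ⟨b, hPE (by simp), Ne.symm hab, hPdep⟩
    · exact ⟨a, hPE (by simp), hab, by rwa [Set.pair_comm]⟩
  -- nullity of `U` is `≥ 3`
  have hnull3 : (M.eRk U).toNat + 3 ≤ U.ncard := by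
    by_contra hlt
    push Not at hlt
    have hν : (∅ ∪ U).ncard ≤ (M.eRk (∅ ∪ U)).toNat + 2 := by simpa using (by omega : U.ncard ≤ (M.eRk U).toNat + 2)
    have := (Set.ncard_le_ncard hpairs (relCircuits_finite M ∅ hUE 2)).trans
      (ncard_relCircuits_le M 2 (by norm_num) 2 ∅ U (empty_subset _) hUE
        (Set.disjoint_left.2 fun a ha => absurd ha (Set.notMem_empty a)) M.empty_indep hν)
    norm_num at this
    omega
  -- `U` is covered by partners, so `U ≠ E` and `2 · rk U ≤ |U|`
  have hpartU : ∀ y ∈ U, ∃ z ∈ U, z ≠ y ∧ M.Dep {y, z} := by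
    intro y hy
    obtain ⟨v, hvE, hvy, hdep⟩ := hy.2
    exact ⟨v, ⟨hvE, y, hy.1, Ne.symm hvy, by rwa [Set.pair_comm]⟩, hvy, hdep⟩
  have hcover := two_mul_eRk_toNat_le_ncard_of_partner M hL U.ncard U hUE rfl hpartU
  have hUne : U ≠ M.E := by
    intro h
    rw [h, eRk_ground_toNat_eq M hd] at hcover
    omega
  have hUnull := ncard_add_one_le_eRk_toNat_add_of_ssubset M hd hK hUE hUne
  have hU6 : U.ncard ≤ 6 := by omega
  by_cases hCU : C ⊆ U
  · -- every point of `C` has a partner; the partners form an injective image outside `C` inside `cl C`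
    have hne : Nonempty α := ⟨Classical.choice (by
      have : C.Nonempty := by rw [← Set.ncard_pos hCfin]; omega
      exact ⟨this.some⟩)⟩
    have hpart : ∀ c ∈ C, ∃ v, v ∈ M.E ∧ v ≠ c ∧ M.Dep {c, v} := fun c hc => by
      obtain ⟨v, hvE, hvc, hdep⟩ := (hCU hc).2
      exact ⟨v, hvE, hvc, hdep⟩
    choose! p hp using hpart
    have hpC : ∀ c ∈ C, p c ∉ C := by
      intro c hc hpc
      obtain ⟨-, hne', hdep⟩ := hp c hc
      exact not_dep_pair_of_isCircuit M hC (by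
        intro w hw; rcases hw with rfl | rfl
        · exact hc
        · exact hpc) (Set.ncard_pair (Ne.symm hne')) hC3 hdep
    have hpcl : ∀ c ∈ C, p c ∈ M.closure C := by
      intro c hc
      obtain ⟨-, -, hdep⟩ := hp c hc
      have hcE : c ∈ M.E := hCE hc
      have := mem_closure_singleton_of_dep_pair M hcE (hL c hcE) hdep
      exact M.closure_subset_closure (Set.singleton_subset_iff.2 hc) this
    have hinj : Set.InjOn p C := by
      intro c hc c' hc' hpp
      by_contra hcc
      obtain ⟨hvE, -, hdep⟩ := hp c hc
      obtain ⟨-, -, hdep'⟩ := hp c' hc'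
      have hLv := hL (p c) hvE
      have h1 : c ∈ M.closure {p c} :=
        mem_closure_singleton_of_dep_pair M hvE hLv (by rwa [Set.pair_comm])
      have h2 : c' ∈ M.closure {p c} := by
        rw [hpp]
        exact mem_closure_singleton_of_dep_pair M (by rw [← hpp]; exact hvE) (by rw [← hpp]; exact hLv)
          (by rwa [Set.pair_comm])
      have hsub : ({c, c'} : Set α) ⊆ M.closure {p c} := by
        intro w hw; rcases hw with rfl | rfl
        · exact h1
        · exact h2
      have hr : M.eRk {c, c'} ≤ 1 := eRk_le_one_of_subset_closure_singleton M hsub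
      have hdep2 : M.Dep {c, c'} := by
        have hfin : ({c, c'} : Set α).Finite := Set.toFinite _
        rw [← Matroid.eRk_lt_encard_iff_dep_of_finite hfin (by
          intro w hw; rcases hw with rfl | rfl
          · exact hCE hc
          · exact hCE hc')]
        rw [Set.encard_pair hcc]
        exact lt_of_le_of_lt hr (by norm_num)
      exact not_dep_pair_of_isCircuit M hC (by
        intro w hw; rcases hw with rfl | rfl
        · exact hc
        · exact hc') (Set.ncard_pair hcc) hC3 hdep2
    set V := C ∪ p '' C with hVdef
    have hVcl : V ⊆ M.closure C := union_subset (M.subset_closure C hCE) (by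
      rintro _ ⟨c, hc, rfl⟩; exact hpcl c hc)
    have hVE : V ⊆ M.E := hVcl.trans (M.closure_subset_ground C)
    have hdisj : Disjoint C (p '' C) := by
      rw [Set.disjoint_left]
      rintro w hw ⟨c, hc, rfl⟩
      exact hpC c hc hw
    have hVcard : V.ncard = 2 * C.ncard := by
      rw [hVdef, Set.ncard_union_eq hdisj hCfin (hCfin.image p), hinj.ncard_image]; ring
    have hVrk : (M.eRk V).toNat + 1 ≤ C.ncard := by
      have h1 : M.eRk V ≤ M.eRk C := by
        calc M.eRk V ≤ M.eRk (M.closure C) := M.eRk_mono hVcl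
          _ = M.eRk C := M.eRk_closure_eq C
      have h2 := hC.eRk_add_one_eq
      rw [← S1.coe_toNat_eRk M hVE, ← S1.coe_toNat_eRk M hCE] at h1
      rw [← S1.coe_toNat_eRk M hCE, ← hCfin.cast_ncard_eq] at h2
      have h1' : (M.eRk V).toNat ≤ (M.eRk C).toNat := by exact_mod_cast h1
      have h2' : (M.eRk C).toNat + 1 = C.ncard := by exact_mod_cast h2
      omega
    have hVne : V ≠ M.E := by
      intro h; rw [h] at hVcard; omega
    have := ncard_add_one_le_eRk_toNat_add_of_ssubset M hd hK hVE hVne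
    omega
  · -- `C ⊄ U`: the nullity of `U ∪ C` is `≥ 4` on `≤ 10 < n` points
    have hstep := S1.nullity_step M hUE hC hCU
    have hUCE : U ∪ C ⊆ M.E := union_subset hUE hCE
    have hUCcard : (U ∪ C).ncard ≤ U.ncard + C.ncard := Set.ncard_union_le U C
    have hUCne : U ∪ C ≠ M.E := by
      intro h; rw [h] at hUCcard; omega
    have := ncard_add_one_le_eRk_toNat_add_of_ssubset M hd hK hUCE hUCne
    omega

end S1CFG

end PercRepro
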